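import Summits.QuantumFields.YangMills.Theorems.ComplexCouplingChannelHarmonicMeasureEngineTorusLegPrelims

/-!
# Zero-free disc from derivative bounds of the free energy at one real point

Helper file for the crux `FreeEnergyWindowChannel` (item `stmt-QuantumFields-18842`, route
`ComplexCouplingChannel` of `QuantumFields/YangMills`), line `Sketch` (transport, layer 2), stub
`stub_zeroFreeOfDerivBounds`.  Pure one-variable complex analysis.

Let `Z : ℂ → ℂ` be entire, real and positive on the real axis (`Z s = ‖Z s‖ ≠ 0` for real `s`), and let
`L s := log ‖Z s‖` (`s` real) be its free energy.  If `|∂ⁿ L (t)| ≤ K · n! · Cⁿ` for all `n ≥ 1` (`C > 0`), then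
`Z` has no zero in the open disc `‖z - t‖ < 1 / C`.

Proof.  LOCAL LOGARITHM (`exists_differentiableOn_exp_eq_near_ofReal`): `Z t ≠ 0`, so `Z` is zero-free on a
small disc `ball t r₀`, where `w ↦ Z (t + w) / Z t` has a normalised holomorphic logarithm (tree lemma
`exists_differentiableOn_exp_eq`); shifting by `log ‖Z t‖` gives `ℓ` holomorphic on `ball t r₀` with `exp ∘ ℓ = Z`
and `ℓ t = log ‖Z t‖`.  REALITY ON THE AXIS: for real `s` near `t`, `exp (ℓ s) = Z s = ‖Z s‖ = exp (L s)`, so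
`ℓ s - L s ∈ 2πiℤ`; it is continuous in `s` and vanishes at `s = t`, hence `|Im (ℓ s - L s)| < π` near `t` and
`ℓ s = L s` there (`Complex.log_exp`).  DERIVATIVES: the iterated derivatives along the reals of a holomorphic
function are its complex iterated derivatives (`iteratedDeriv_comp_ofReal`, induction with
`HasDerivAt.comp_ofReal`), and `iteratedDeriv` commutes with the coercion `ℝ → ℂ` (`iteratedDeriv_ofReal_comp`,
induction with `HasDerivAt.ofReal_comp`); therefore `∂ⁿ ℓ (t) = ∂ⁿ L (t)`.  TAYLOR SERIES: the power series
`Σ aₙ (z - t)ⁿ`, `aₙ := ∂ⁿ ℓ (t) / n!`, has `‖aₙ‖ ≤ K Cⁿ` (`n ≥ 1`), hence radius `≥ 1 / C`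
(`FormalMultilinearSeries.le_radius_of_bound`), so its sum `G` is holomorphic on `ball t (1 / C)`; by Taylor's
theorem (`Complex.taylorSeries_eq_on_ball'`) `G = ℓ` on `ball t r₀`.  IDENTITY THEOREM: `exp ∘ G` and `Z` are
holomorphic on the preconnected disc `ball t (1 / C)` and agree near `t`, hence on the whole disc
(`AnalyticOnNhd.eqOn_of_preconnected_of_eventuallyEq`), so `Z = exp ∘ G ≠ 0` there.

References: tree `exists_differentiableOn_exp_eq` (`ComplexCouplingChannelHarmonicMeasureEngineTorusLegPrelims.lean`);
Mathlib `Complex.taylorSeries_eq_on_ball'`, `FormalMultilinearSeries.hasFPowerSeriesOnBall`,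
`AnalyticOnNhd.eqOn_of_preconnected_of_eventuallyEq`, `HasDerivAt.comp_ofReal`, `HasDerivAt.ofReal_comp`.
-/

open Complex Metric Set Filter Topology

namespace Summit.QuantumFields.YangMills.Theorems.FreeEnergyWindowChannel

open Summit.QuantumFields.YangMills.Theorems.ComplexCouplingChannel

/-- **Iterated derivatives along the reals of a holomorphic function.**  If `f` is holomorphic on an open
`U ⊆ ℂ`, then at every real point `s` with `↑s ∈ U` the `n`-th derivative of the restriction `x ↦ f ↑x`
(`x : ℝ`) is the `n`-th complex derivative of `f` at `↑s`.  Induction on `n` (`HasDerivAt.comp_ofReal`, the first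
derivatives agreeing on the open set `(↑)⁻¹' U`). [folklore] -/
theorem iteratedDeriv_comp_ofReal {U : Set ℂ} (hU : IsOpen U) (n : ℕ) :
    ∀ {f : ℂ → ℂ}, DifferentiableOn ℂ f U → ∀ {s : ℝ}, (s : ℂ) ∈ U →
      iteratedDeriv n (fun x : ℝ => f x) s = iteratedDeriv n f s := by
  induction n with
  | zero => intro f _ s _; simp
  | succ n ih =>
    intro f hf s hs
    rw [iteratedDeriv_succ', iteratedDeriv_succ', ← ih (hf.deriv hU) hs]
    refine Filter.EventuallyEq.iteratedDeriv_eq n ?_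
    filter_upwards [continuous_ofReal.continuousAt.preimage_mem_nhds (hU.mem_nhds hs)] with x hx
    exact (hf.differentiableAt (hU.mem_nhds hx)).hasDerivAt.comp_ofReal.deriv

/-- **`iteratedDeriv` commutes with the coercion `ℝ → ℂ`**: for every `f : ℝ → ℝ`,
`∂ⁿ (x ↦ ↑(f x)) = (x ↦ ↑(∂ⁿ f x))`.  Induction on `n` (`HasDerivAt.ofReal_comp`; at points where `f` is not
differentiable both first derivatives vanish, `x ↦ ↑(f x)` being differentiable iff `f = re ∘ (↑f)` is). [folklore] -/
theorem iteratedDeriv_ofReal_comp (n : ℕ) :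
    ∀ f : ℝ → ℝ, iteratedDeriv n (fun x : ℝ => ((f x : ℝ) : ℂ)) = fun x => ((iteratedDeriv n f x : ℝ) : ℂ) := by
  induction n with
  | zero => intro f; simp
  | succ n ih =>
    intro f
    rw [iteratedDeriv_succ', iteratedDeriv_succ', ← ih (deriv f)]
    congr 1
    funext x
    by_cases h : DifferentiableAt ℝ f x
    · exact h.hasDerivAt.ofReal_comp.deriv
    · rw [deriv_zero_of_not_differentiableAt h, ofReal_zero, deriv_zero_of_not_differentiableAt]
      exact fun h' => h (by simpa [Function.comp_def] using reCLM.differentiableAt.comp x h')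

/-- **Local holomorphic logarithm, real-normalised at a real point.**  If `Z` is entire with `Z t = ‖Z t‖ ≠ 0` at
the real point `t`, then on some disc `ball t r` (`r > 0`) there is a holomorphic `ℓ` with `exp ∘ ℓ = Z` and
`ℓ t = log ‖Z t‖`.  Proof: `Z` is zero-free near `t` by continuity; apply the tree's normalised logarithm
`exists_differentiableOn_exp_eq` to `w ↦ Z (t + w) / Z t` and shift by `log ‖Z t‖`. [folklore] -/
theorem exists_differentiableOn_exp_eq_near_ofReal {Z : ℂ → ℂ} {t : ℝ} (hZ : Differentiable ℂ Z)
    (hreal : Z t = ((‖Z t‖ : ℝ) : ℂ)) (hne : Z t ≠ 0) :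
    ∃ r : ℝ, 0 < r ∧ ∃ ℓ : ℂ → ℂ, DifferentiableOn ℂ ℓ (ball (t : ℂ) r) ∧
      ℓ t = ((Real.log ‖Z t‖ : ℝ) : ℂ) ∧ ∀ w ∈ ball (t : ℂ) r, exp (ℓ w) = Z w := by
  -- a zero-free disc around `t`
  obtain ⟨r, hr, hrU⟩ := Metric.isOpen_iff.1 (isOpen_compl_singleton.preimage hZ.continuous) (t : ℂ)
    (mem_preimage.2 (mem_compl_singleton_iff.2 hne))
  -- the normalised function `w ↦ Z (t + w) / Z t` on `ball 0 r`
  set W : ℂ → ℂ := fun w => Z (t + w) / Z t with hW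
  have hWd : DifferentiableOn ℂ W (ball 0 r) := by
    refine Differentiable.differentiableOn ?_
    rw [hW]
    fun_prop
  have hW0 : ∀ w ∈ ball (0 : ℂ) r, W w ≠ 0 := fun w hw => by
    refine div_ne_zero (hrU ?_) hne
    rw [mem_ball_iff_norm, add_sub_cancel_left]
    exact mem_ball_zero_iff.1 hw
  have hW1 : W 0 = 1 := by simp [hW, hne]
  obtain ⟨g, hgd, hg0, hge⟩ := exists_differentiableOn_exp_eq hr hWd hW0 hW1
  refine ⟨r, hr, fun w => g (w - t) + ((Real.log ‖Z t‖ : ℝ) : ℂ), ?_, by simp [hg0], fun w hw => ?_⟩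
  · refine (hgd.comp (differentiableOn_id.sub_const _) fun w hw => ?_).add_const _
    exact mem_ball_zero_iff.2 (mem_ball_iff_norm.1 hw)
  · have hwt : w - t ∈ ball (0 : ℂ) r := mem_ball_zero_iff.2 (mem_ball_iff_norm.1 hw)
    rw [exp_add, hge _ hwt, hW]
    dsimp only
    rw [add_sub_cancel, ← ofReal_exp, Real.exp_log (norm_pos_iff.2 hne), ← hreal]
    exact div_mul_cancel₀ _ hne

/-- **Zero-free disc from derivative bounds at one real point** (stub `stub_zeroFreeOfDerivBounds` of the line
`Sketch`, transport, layer 2).  Let `Z` be entire, real and positive on the real axis (`Z s = ‖Z s‖ ≠ 0` for real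
`s`), and suppose the real free energy `L s := log ‖Z s‖` satisfies `|∂ⁿ L (t)| ≤ K · n! · Cⁿ` for all `n ≥ 1`
(`C > 0`).  Then `Z z ≠ 0` whenever `‖z - t‖ < C⁻¹`.  Proof: local holomorphic logarithm `ℓ` of `Z` near `t`,
equal to `L` on the real axis near `t`, so `∂ⁿ ℓ (t) = ∂ⁿ L (t)`; the Taylor series of `ℓ` at `t` has radius
`≥ 1 / C` and its sum `G` continues `ℓ`; `exp ∘ G = Z` on the disc by the identity theorem. [folklore] -/
theorem stub_zeroFreeOfDerivBounds :
    ∀ (Z : ℂ → ℂ) (t C K : ℝ), 0 < C → Differentiable ℂ Z →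
      (∀ s : ℝ, Z (s : ℂ) = ((‖Z (s : ℂ)‖ : ℝ) : ℂ)) → (∀ s : ℝ, Z (s : ℂ) ≠ 0) →
      (∀ n : ℕ, 1 ≤ n → |iteratedDeriv n (fun s : ℝ => Real.log ‖Z (s : ℂ)‖) t| ≤ K * n.factorial * C ^ n) →
      ∀ z : ℂ, ‖z - (t : ℂ)‖ < C⁻¹ → Z z ≠ 0 := by
  intro Z t C K hC hZ hreal hne hbd z hz
  set L : ℝ → ℝ := fun s => Real.log ‖Z (s : ℂ)‖ with hL
  have hC' : 0 < C⁻¹ := inv_pos.2 hC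
  -- STEP 1: local holomorphic logarithm `ℓ` of `Z` on `ball t r₀`, `ℓ t = log ‖Z t‖`
  obtain ⟨r₀, hr₀, ℓ, hℓd, hℓt, hexp⟩ := exists_differentiableOn_exp_eq_near_ofReal hZ (hreal t) (hne t)
  have hballt : ball (t : ℂ) r₀ ∈ 𝓝 ((t : ℝ) : ℂ) := isOpen_ball.mem_nhds (mem_ball_self hr₀)
  -- STEP 2: on the real axis near `t`, `ℓ = L`
  have hLℓ : (fun s : ℝ => ℓ s) =ᶠ[𝓝 t] fun s : ℝ => ((L s : ℝ) : ℂ) := by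
    have hc : ContinuousAt (fun s : ℝ => ℓ s - ((L s : ℝ) : ℂ)) t := by
      refine ((hℓd.differentiableAt hballt).continuousAt.comp continuous_ofReal.continuousAt).sub ?_
      exact continuous_ofReal.continuousAt.comp
        (((hZ.continuous.comp continuous_ofReal).continuousAt.norm.log (norm_ne_zero_iff.2 (hne t))))
    have h0 : ℓ t - ((L t : ℝ) : ℂ) = 0 := by
      show ℓ t - ((Real.log ‖Z (t : ℂ)‖ : ℝ) : ℂ) = 0
      rw [hℓt, sub_self]
    have h1 : ∀ᶠ s : ℝ in 𝓝 t, (s : ℂ) ∈ ball (t : ℂ) r₀ :=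
      continuous_ofReal.continuousAt.preimage_mem_nhds hballt
    have h2 : ∀ᶠ s : ℝ in 𝓝 t, ℓ s - ((L s : ℝ) : ℂ) ∈ ball (0 : ℂ) Real.pi := by
      refine hc.eventually_mem ?_
      show ball (0 : ℂ) Real.pi ∈ 𝓝 (ℓ t - ((L t : ℝ) : ℂ))
      rw [h0]
      exact ball_mem_nhds _ Real.pi_pos
    filter_upwards [h1, h2] with s hs1 hs2
    have hE : exp (ℓ s - ((L s : ℝ) : ℂ)) = 1 := by
      have hs : exp ((L s : ℝ) : ℂ) = Z s := by
        show exp ((Real.log ‖Z (s : ℂ)‖ : ℝ) : ℂ) = Z s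
        rw [← ofReal_exp, Real.exp_log (norm_pos_iff.2 (hne s)), ← hreal s]
      rw [exp_sub, hexp _ hs1, hs, div_self (hne s)]
    have him : |(ℓ s - ((L s : ℝ) : ℂ)).im| < Real.pi := (abs_im_le_norm _).trans_lt (mem_ball_zero_iff.1 hs2)
    rw [← sub_eq_zero, ← Complex.log_exp (abs_lt.1 him).1 (abs_lt.1 him).2.le, hE, Complex.log_one]
  -- STEP 3: the complex Taylor coefficients of `ℓ` at `t` are the real ones of `L`
  have hder : ∀ n : ℕ, iteratedDeriv n ℓ (t : ℂ) = ((iteratedDeriv n L t : ℝ) : ℂ) := fun n => by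
    rw [← iteratedDeriv_comp_ofReal isOpen_ball n hℓd (mem_ball_self hr₀), hLℓ.iteratedDeriv_eq n,
      iteratedDeriv_ofReal_comp]
  -- STEP 4: the Taylor series of `ℓ` at `t` has radius `≥ C⁻¹`; its sum `G` is holomorphic on `ball t C⁻¹`
  -- and agrees with `ℓ` on `ball t r₀`
  set a : ℕ → ℂ := fun n => ((n.factorial : ℕ) : ℂ)⁻¹ * iteratedDeriv n ℓ t with ha
  have hcoef : ∀ n : ℕ, 1 ≤ n → ‖a n‖ ≤ K * C ^ n := fun n hn => by
    have hfac : (0 : ℝ) < n.factorial := by positivity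
    simp only [ha, hder, norm_mul, norm_inv, Complex.norm_natCast, Complex.norm_real, Real.norm_eq_abs]
    rw [inv_mul_le_iff₀ hfac]
    calc |iteratedDeriv n L t| ≤ K * n.factorial * C ^ n := hbd n hn
      _ = n.factorial * (K * C ^ n) := by ring
  obtain ⟨R, hRC⟩ : ∃ R : NNReal, (R : ℝ) = C⁻¹ := ⟨⟨C⁻¹, hC'.le⟩, rfl⟩
  have hbound : ∀ n : ℕ, ‖FormalMultilinearSeries.ofScalars ℂ a n‖ * (R : ℝ) ^ n ≤ max K ‖a 0‖ := by
    intro n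
    rw [FormalMultilinearSeries.ofScalars_norm, hRC]
    rcases Nat.eq_zero_or_pos n with rfl | hn
    · simp
    · calc ‖a n‖ * C⁻¹ ^ n ≤ K * C ^ n * C⁻¹ ^ n := by gcongr; exact hcoef n hn
        _ = K := by rw [mul_assoc, ← mul_pow, mul_inv_cancel₀ hC.ne', one_pow, mul_one]
        _ ≤ max K ‖a 0‖ := le_max_left _ _
  have hrad : (R : ENNReal) ≤ (FormalMultilinearSeries.ofScalars ℂ a).radius :=
    FormalMultilinearSeries.le_radius_of_bound _ _ hbound
  have hRpos : (0 : ENNReal) < R := by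
    have : (0 : ℝ) < R := hRC ▸ hC'
    exact_mod_cast this
  set p : FormalMultilinearSeries ℂ ℂ ℂ := FormalMultilinearSeries.ofScalars ℂ a with hp
  have hps : DifferentiableOn ℂ p.sum (ball (0 : ℂ) C⁻¹) := by
    have h := (p.hasFPowerSeriesOnBall (hRpos.trans_le hrad)).differentiableOn.mono
      (Metric.eball_subset_eball hrad)
    rwa [Metric.eball_coe, hRC] at h
  set G : ℂ → ℂ := fun w => p.sum (w - t) with hG
  have hGd : DifferentiableOn ℂ G (ball (t : ℂ) C⁻¹) :=
    hps.comp (differentiableOn_id.sub_const _) fun w hw => mem_ball_zero_iff.2 (mem_ball_iff_norm.1 hw)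
  have hGℓ : ∀ w ∈ ball (t : ℂ) r₀, G w = ℓ w := fun w hw => by
    rw [← Complex.taylorSeries_eq_on_ball' hw hℓd]
    show (FormalMultilinearSeries.ofScalars ℂ a).sum (w - t) = _
    unfold FormalMultilinearSeries.sum
    exact tsum_congr fun n => by rw [FormalMultilinearSeries.ofScalars_apply_eq, smul_eq_mul]
  -- STEP 5: identity theorem on the preconnected disc `ball t C⁻¹`
  have hEq : EqOn (fun w => exp (G w)) Z (ball (t : ℂ) C⁻¹) := by
    refine AnalyticOnNhd.eqOn_of_preconnected_of_eventuallyEq (hGd.cexp.analyticOnNhd isOpen_ball)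
      (hZ.differentiableOn.analyticOnNhd isOpen_ball) (convex_ball _ _).isPreconnected (mem_ball_self hC') ?_
    filter_upwards [hballt] with w hw
    rw [hGℓ w hw, hexp w hw]
  rw [← hEq (mem_ball_iff_norm.2 hz)]
  exact exp_ne_zero _

end Summit.QuantumFields.YangMills.Theorems.FreeEnergyWindowChannel
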